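import Summits.QuantumFields.YangMills.Theorems.GronwallGapContinuumFromLatticeGapDecayOfUniform
import HarnessLib

/-!
# `ContinuumFromLatticeGap` (stmt-QuantumFields-15915), line `registered`, reshape 6: the decay leg from UNIFORM monomial
# constants — density step (`stub_decayOfUniformMonomials`)

Support file for the crux item stmt-QuantumFields-15915 (`GronwallGap.ContinuumFromLatticeGap`), reshape 6 of line
`registered`: the registered sub-goal `stub_decayOfUniformMonomials` — `Decay (planeSum T) (Δ/2)` from ONE clustering
constant per (arity, box) for the reflected diagonal pairs of plaquette monomials along the scheme (UNIFORM) absorbed by the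
volumes — from `decay_separated_uniform` on the dense separated class, by density (`separatedDensity_of_isOffDiagonal`) and
continuity of the connected OS forms.  No RP-spectral / thermal input.  No definitions, no named facts.
Refs: OsterwalderSeiler1978 §§2–3; GlimmJaffe1987 §6.1, §19.7; OsterwalderSchrader1973 §4.
-/

noncomputable section

open scoped SchwartzMap BigOperators ComplexConjugate
open MeasureTheory Filter Topology
open Literature.MathematicalPhysics.QuantumFieldTheory Literature.MathematicalPhysics.QuantumLattice
open Literature.MathematicalPhysics.AQFT
open Literature.Probability.LatticeModels (box Site mem_box)
open Summit.QuantumFields.YangMills.Cruxes.HypercubicLimit.CouplingResponse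
open Summit.QuantumFields.YangMills.Cruxes.OSLegsFromFemtoAndGap.DlrCollarTransfer (plane conn Decay)
open Summit.QuantumFields.YangMills.Cruxes.OSLegsAtWeakCouplingC.Sketch (Separated)
open Summit.QuantumFields.YangMills.Theorems.OSLegsFromFemtoAndGap
open Summit.QuantumFields.YangMills.Theorems.WeakCouplingHypercubicLimit.TraceNormColdPressure

namespace Summit.QuantumFields.YangMills.Theorems.ContinuumFromLatticeGap

/-- **`stub_decayOfUniformMonomials`** (registered sub-goal of line `registered`, reshape 6, crux stmt-QuantumFields-15915) —
**the decay leg from UNIFORM monomial constants**: along a scheme at (eventually) non-negative coupling with polynomial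
renormalisation and a bounded counterterm, ONE clustering constant `Cmono n d ≥ 1` per (arity, box) for the reflected diagonal
pairs of plaquette monomials on the scheme's own tori at rate `Δ a_k`, absorbed by the volumes, gives exponential decay at rate
`Δ/2` of the diagonal connected OS form of the plane limits (`Decay (planeSum T) (Δ/2)`): `decay_separated_uniform` on the dense
class of real test functions compactly supported at separated positive-time points, then density
(`separatedDensity_of_isOffDiagonal`) and continuity of the connected OS forms.  No RP-spectral / thermal input. [folklore] -/
theorem stub_decayOfUniformMonomials :
    ∀ (G : Type) [Group G] [TopologicalSpace G] [IsTopologicalGroup G] [CompactSpace G]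
      [MeasurableSpace G] [BorelSpace G] (r : LatticeRep G) (sch : SpeciesScheme (YMSpecies G))
      (φ : ℕ → ℕ) (hφ : StrictMono φ)
      (T : (n : ℕ) → (Fin n → Plane) → (𝓢((Fin n → EuclideanSpace ℝ (Fin 4)), ℂ) →L[ℂ] ℂ)) (Δ : ℝ)
      (Cmono : ℕ → ℕ → ℝ),
      0 < Δ → PolyRenorm r sch → (∃ Cm : ℝ, ∀ k, |sch.m r.curvature k| ≤ Cm) → (∀ᶠ k in atTop, 0 ≤ sch.β k) →
        UniformFunctionalBoundPlanes r sch → PlaneLimits r sch φ T → (∀ n d, 1 ≤ Cmono n d) →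
        (∀ (n d : ℕ) (q : Fin n → Fin 4 × Fin 4) (y : Fin n → Site 4),
          (∀ l, (0 ≤ y l 0 ∧ y l 0 ≤ (d : ℤ)) ∧ ∀ i : Fin 4, i ≠ 0 → |y l i| ≤ (d : ℤ)) →
          ∀ (s : Finset (Fin n)) (k j : ℕ), j ≤ sch.L k →
            latticeConnectedCorr r.ρ (sch.β k) (2 * sch.L k + 1)
                ((fun V => ∏ l ∈ s, plane G r (q l) (y l) V) ∘ gaugeTimeReflect)
                (fun V => ∏ l ∈ s, plane G r (q l) (y l) V) j ≤ Cmono n d * Real.exp (-(Δ * sch.a k * j))) →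
        (∀ n ρ : ℕ, Tendsto (fun k => (Real.log (Cmono n (⌊(ρ : ℝ) / sch.a k⌋₊ + 2)) + |Real.log (sch.a k)|) /
          (sch.a k * (sch.L k : ℝ))) atTop (𝓝 0)) →
        Decay (planeSum T) (Δ / 2) := by
  intro G _ _ _ _ _ _ r sch φ hφ T Δ Cmono hΔ hpr hbm hβ0 hUFB hPL hC1 hmono habs n F hFo hFp hFc hFr t ht
  obtain ⟨u, hu_c, hu_sep, hu_supp, hu_real, hu_lim⟩ := separatedDensity_of_isOffDiagonal n F hFo
  have hreal := hu_real hFr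
  -- each approximant satisfies the inequality
  have hkey : ∀ m, (conn (planeSum T) (u m) (translateMulti (EuclideanSpace.single (0 : Fin 4) t) (u m))).re ≤
      (conn (planeSum T) (u m) (u m)).re * Real.exp (-(Δ / 2 * t)) := by
    intro m
    obtain ⟨δ, hδ, hsep⟩ := hu_sep m
    have hpos : tsupport (u m : (Fin n → EuclideanSpace ℝ (Fin 4)) → ℂ) ⊆ {v | ∀ l, 0 < v l 0} :=
      fun v hv => hFp (hu_supp m hv)
    obtain ⟨τ, hτ, hFτ⟩ := exists_time_floor (hu_c m) hpos
    obtain ⟨ρ, hρ, hFρ⟩ := exists_radius (hu_c m)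
    exact decay_separated_uniform r sch φ hφ T hUFB hPL hτ hδ hρ hFρ hFτ hsep (hreal m) hpr hbm hβ0 hΔ Cmono hC1
      hmono habs ht
  -- pass to the limit along the approximants
  have h1 := ((continuous_conn_translateMulti (planeSum T) n (EuclideanSpace.single (0 : Fin 4) t)).tendsto F).comp hu_lim
  have h2 := ((continuous_conn_self (planeSum T) n).tendsto F).comp hu_lim
  exact le_of_tendsto_of_tendsto ((Complex.continuous_re.tendsto _).comp h1)
    (((Complex.continuous_re.tendsto _).comp h2).mul_const _) (Eventually.of_forall hkey)

end Summit.QuantumFields.YangMills.Theorems.ContinuumFromLatticeGap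

end
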